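import Summits.BirchSwinnertonDyer.Rank1Residual.Additive.KobayashiSignedGenerationDischarge
import Summits.BirchSwinnertonDyer.Rank1Residual.Additive.PadicCyclotomicIntegers
import Literature.NumberTheory.EllipticCurves.GoodReductionLangLift
import HarnessLib

/-!
# Prime-to-`p` saturation of `E₁` on the cyclotomic layers (`hsat` DISCHARGED): for a good
# `ℤ_p`-model `M`, every point of `E(ℚ̄_p)` with coordinates in `ℚ_p(ζ_{p^m})` is killed modulo
# `E₁` by `#Ẽ(𝔽_p)` — reduction modulo the maximal ideal of `𝒪_{ℚ̄_p}` lands in `Ẽ(𝔽_p)`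
# (cell `b2b-bsdres`, CLASS-CLOSURE lane, class O10 — x1b GEN 34, class lead; file 37 of the local series)

HONEST FRAMING (cell `b2b-bsdres`, run/shared/lean/b2b/bsd-rank1-residual/, verbatim in every
file): the goal of the cell is to DELETE the COMBINATION-SHAPED residual classes of the
Birch–Swinnerton-Dyer formula for ALL analytic-rank `≤ 1` elliptic curves over `ℚ` — "full BSD
formula for every rank `≤ 1` curve in class `C`" assembled STRICTLY from published theorems — so
that the rank-`≤ 1` remainder becomes exactly the CONSTRUCTION-SHAPED classes, which are TYPED
(missing-input `Prop`s), NOT attempted. This is not "finishing BSD". CLASS-CLOSURE lane: prove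
what is provable now; shrink each hard class to its core with data; no claim beyond stated classes;
research routes on CONSTRUCTION-SHAPED X12 / O10; census / instrument output = EVIDENCE / conjecture
items, NEVER a Literature fact; `RESIDUAL-MAP.md` marks change only by signed lines. THIS FILE:
TOOL DEFINITIONS + THEOREMS (definitions with bodies: `intΩ` = the valuation ring of `ℚ̄_p`,
`padicIntToIntΩ : ℤ_p → 𝒪`, `zmodToResidueΩ : 𝔽_p → 𝒪/𝔪`, `modelΩ M = M ⊗ 𝒪`; every statement
proved) — no named Literature fact, no Summits-side fact `def … : Prop`, no `sorry`, axioms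
standard; nothing is booked; no label / mark / count / sub-cell moves; O10 stays OPEN /
CONSTRUCTION-SHAPED; nothing about `BSD(W, p)` of any pair is claimed.

## Content (`Ω = PadicAlgCl p`, `𝒪 = intΩ p = {v ≤ 1}`, `k = 𝒪/𝔪`, `E_Ω = genFibΩ p M`)

* §1 `𝒪`, the map `ℤ_p → 𝒪`, `M ⊗ 𝒪` with `(M ⊗ 𝒪) ⊗ Ω = E_Ω`; `char k = p`, `𝔽_p → k`; the
  reduction of `M ⊗ 𝒪` is `(M mod p) ⊗ k` (`modelΩ_map_residue`); `Δ(M) ∈ ℤ_p^×` from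
  `(M mod p)` elliptic.
* §2 **Residues of layer integers lie in `𝔽_p`**: `x ∈ ℚ_p(ζ_{p^m})`, `‖x‖ ≤ 1` ⟹ `‖x − a‖ < 1` for
  some `a : ℕ` (`𝒪_m = ℤ_p[ζ − 1]`, file PadicCyclotomicIntegers, and `‖ζ − 1‖ < 1`).
* §3 **The reduction of a layer point is an `𝔽_p`-point**: for `Q ∈ E_Ω` with coordinates in a
  layer, `red(Q) = ι(Q₀)` with `Q₀ ∈ Ẽ(𝔽_p)` (`goodReductionHom` of the tree's
  `GeomPointReduction` / `ReductionHomomorphism`, Silverman VII.2.1).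
* §4 **`#Ẽ(𝔽_p) • Q ∈ E₁`** (`card_smul_mem_kernel_of_mem_subfieldPoints`; Lagrange in `Ẽ(𝔽_p)` and
  `ker(red) = E₁`), and the `hsat` hypothesis of `localFixedPointsOfEmb_le_sup_towerSigned`
  (file KobayashiSignedGenerationDischarge) in its exact shape, for every tower `U` with
  `(U n)_{ℚ_p} = Stab(ζ_{p^{n+1}})` and `a_p(M) = 0` (`#Ẽ(𝔽_p) = p + 1`, prime to `p`):
  **`hsat_of_stab`**.

References: [SilvermanAEC2009] VII.2 Prop. 2.1 (reduction homomorphism, kernel `E₁`);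
[Kobayashi2003] §8.4 (proof of Prop. 8.12: `E(k_n)/Ê(m_n) ↪ Ẽ(𝔽_p)`); [SerreLocalFields1979] IV §4.
-/

noncomputable section

open scoped Classical NNReal
open Polynomial Finset

namespace Summit.BirchSwinnertonDyer.Rank1Residual.Additive

open Literature.NumberTheory.EllipticCurves Literature.NumberTheory.GaloisRepresentations
  Literature.NumberTheory.EllipticCurves.FormalGroupChart WeierstrassCurve PadicCyclotomicTower BallEval Field

variable (p : ℕ) [hp : Fact p.Prime]

/-! ## §1 The valuation ring of `ℚ̄_p`, its residue field, and the model over it -/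

/-- **The valuation ring `𝒪 = {‖x‖ ≤ 1}` of `Ω = ℚ̄_p`** (Mathlib's `Valuation.valuationSubring` of
the `Valued` structure of `PadicAlgCl p`). [folklore] -/
abbrev intΩ : ValuationSubring (PadicAlgCl p) := (Valued.v (R := PadicAlgCl p)).valuationSubring

variable {p} in
/-- Membership in `𝒪`: `‖x‖ ≤ 1`. [folklore] -/
theorem mem_intΩ_iff (x : PadicAlgCl p) : x ∈ intΩ p ↔ ‖x‖ ≤ 1 := by
  rw [Valuation.mem_valuationSubring_iff, v_le_iff_norm_le, NNReal.coe_one]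

/-- `𝒪` is the ring of integers of `v` (the hypothesis `hv` of the tree's reduction files). [folklore] -/
theorem integers_intΩ : (Valued.v (R := PadicAlgCl p)).Integers (intΩ p) :=
  Valuation.valuationSubring.integers _

/-- **`ℤ_p → 𝒪`** (the structure map `ℤ_p → ℚ_p → Ω`, corestricted). [folklore] -/
def padicIntToIntΩ : ℤ_[p] →+* intΩ p :=
  ((algebraMap ℚ_[p] (PadicAlgCl p)).comp (PadicInt.Coe.ringHom (p := p))).codRestrict (intΩ p)
    (fun c => (mem_intΩ_iff _).mpr (by
      rw [RingHom.comp_apply, norm_algebraMap']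
      exact PadicInt.norm_le_one c))

/-- `padicIntToIntΩ c`, read in `Ω`, is `c`. [folklore] -/
@[simp] theorem coe_padicIntToIntΩ (c : ℤ_[p]) :
    ((padicIntToIntΩ p c : intΩ p) : PadicAlgCl p) = algebraMap ℚ_[p] (PadicAlgCl p) (c : ℚ_[p]) := rfl

/-- `v(p) < 1` on `𝒪`: the residue of `p` vanishes. [folklore] -/
theorem residue_natCast_prime_eq_zero : IsLocalRing.residue (intΩ p) (p : intΩ p) = 0 := by
  rw [← v_algebraMap_lt_one_iff (integers_intΩ p)]
  rw [map_natCast]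
  exact v_prime_lt_one

/-- **The residue field `k = 𝒪/𝔪` of `ℚ̄_p` has characteristic `p`.** [folklore] -/
theorem charP_residueField_intΩ : CharP (IsLocalRing.ResidueField (intΩ p)) p := by
  refine ringChar.of_eq (CharP.ringChar_of_prime_eq_zero hp.out ?_)
  have := residue_natCast_prime_eq_zero p
  simpa using this

/-- **`𝔽_p → k`** (`ZMod.castHom` for the characteristic-`p` field `k`). [folklore] -/
def zmodToResidueΩ : ZMod p →+* IsLocalRing.ResidueField (intΩ p) :=
  haveI := charP_residueField_intΩ p
  ZMod.castHom (dvd_refl p) _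

/-- `𝔽_p → k` on a natural number. [folklore] -/
@[simp] theorem zmodToResidueΩ_natCast (n : ℕ) : zmodToResidueΩ p (n : ZMod p) = n :=
  map_natCast _ n

/-- `𝔽_p → k` is injective. [folklore] -/
theorem zmodToResidueΩ_injective : Function.Injective (zmodToResidueΩ p) :=
  (zmodToResidueΩ p).injective

/-- **Residues of `ℤ_p`-elements**: `residue (c) = (c mod p)` read in `k`. [folklore] -/
theorem residue_padicIntToIntΩ (c : ℤ_[p]) :
    IsLocalRing.residue (intΩ p) (padicIntToIntΩ p c) = zmodToResidueΩ p (PadicInt.toZMod c) := by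
  have h1 : c - (c.zmodRepr : ℤ_[p]) ∈ IsLocalRing.maximalIdeal ℤ_[p] := PadicInt.sub_zmodRepr_mem c
  rw [PadicInt.maximalIdeal_eq_span_p, Ideal.mem_span_singleton] at h1
  obtain ⟨t, ht⟩ := h1
  have hc : c = (c.zmodRepr : ℤ_[p]) + p * t := by rw [← ht]; ring
  have h2 : PadicInt.toZMod c = (c.zmodRepr : ZMod p) := by
    rw [← ZMod.natCast_zmod_val (PadicInt.toZMod c), PadicInt.val_toZMod_eq_zmodRepr]
  have hp0 : (p : IsLocalRing.ResidueField (intΩ p)) = 0 := by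
    have := residue_natCast_prime_eq_zero p
    rwa [map_natCast] at this
  conv_lhs => rw [hc]
  rw [map_add, map_natCast, map_mul, map_natCast, map_add, map_mul, map_natCast, map_natCast,
    hp0, zero_mul, add_zero, h2, zmodToResidueΩ_natCast]

/-- **The model `M ⊗ 𝒪`** of a Weierstrass equation `M/ℤ_p` over the valuation ring of `Ω`. [folklore] -/
abbrev modelΩ (M : WeierstrassCurve ℤ_[p]) : WeierstrassCurve (intΩ p) := M.map (padicIntToIntΩ p)

/-- `(M ⊗ 𝒪) ⊗ Ω = E_Ω` (`= (M ⊗ ℚ_p) ⊗ Ω`, the curve `genFibΩ p M` of the series). [folklore] -/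
theorem modelΩ_baseChange (M : WeierstrassCurve ℤ_[p]) :
    (modelΩ p M).baseChange (PadicAlgCl p) = genFibΩ p M := by
  rw [genFibΩ, WeierstrassCurve.baseChange, WeierstrassCurve.baseChange, WeierstrassCurve.map_map,
    WeierstrassCurve.map_map]
  rfl

/-- **The reduction of `M ⊗ 𝒪` is `(M mod p) ⊗_{𝔽_p} k`.** [folklore] -/
theorem modelΩ_map_residue (M : WeierstrassCurve ℤ_[p]) :
    (modelΩ p M).map (IsLocalRing.residue (intΩ p)) = (M.map PadicInt.toZMod).map (zmodToResidueΩ p) := by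
  rw [WeierstrassCurve.map_map, WeierstrassCurve.map_map]
  congr 1
  ext c
  exact residue_padicIntToIntΩ p c

/-- `Δ(M) ∈ ℤ_p^×` when `M mod p` is an elliptic curve. [folklore] -/
theorem isUnit_Δ_of_isElliptic_toZMod (M : WeierstrassCurve ℤ_[p]) [hEt : (M.map PadicInt.toZMod).IsElliptic] :
    IsUnit M.Δ := by
  by_contra h
  have hmem : M.Δ ∈ IsLocalRing.maximalIdeal ℤ_[p] := h
  rw [← PadicInt.ker_toZMod, RingHom.mem_ker] at hmem
  have hu := hEt.isUnit
  rw [WeierstrassCurve.map_Δ, hmem] at hu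
  exact not_isUnit_zero hu

/-- `Δ(M ⊗ 𝒪) ∈ 𝒪^×` when `M mod p` is an elliptic curve. [folklore] -/
theorem isUnit_Δ_modelΩ (M : WeierstrassCurve ℤ_[p]) [(M.map PadicInt.toZMod).IsElliptic] :
    IsUnit (modelΩ p M).Δ := by
  rw [WeierstrassCurve.map_Δ]
  exact (isUnit_Δ_of_isElliptic_toZMod p M).map _

/-! ## §2 Residues of layer integers lie in `𝔽_p` -/

variable {p}

/-- An integral element of a layer is congruent to an element of `ℤ_p` modulo `𝔪_Ω`: for
`x ∈ ℚ_p(ζ_{p^m})` with `‖x‖ ≤ 1` there is `c ∈ ℚ_p`, `‖c‖ ≤ 1`, with `‖x − c‖ < 1`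
(`x = r(ζ − 1)` with `r ∈ ℤ_p[X]`, `c = r(0)`, `‖ζ − 1‖ < 1`). [cite: SerreLocalFields1979, Ch. IV §4] -/
theorem exists_padic_norm_sub_lt_one {m : ℕ} {x : PadicAlgCl p} (hx : x ∈ layer p m) (hx1 : ‖x‖ ≤ 1) :
    ∃ c : ℚ_[p], ‖c‖ ≤ 1 ∧ ‖x - algebraMap ℚ_[p] (PadicAlgCl p) c‖ < 1 := by
  rcases Nat.eq_zero_or_pos m with rfl | hm
  · rw [layer_zero, IntermediateField.mem_bot] at hx
    obtain ⟨c, rfl⟩ := hx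
    refine ⟨c, by rwa [norm_algebraMap'] at hx1, ?_⟩
    rw [sub_self, norm_zero]; exact zero_lt_one
  · obtain ⟨r, -, hr, hrx⟩ := exists_intPoly_aeval_eq p hm hx hx1
    refine ⟨r.coeff 0, hr 0, ?_⟩
    set π : PadicAlgCl p := zeta p m - 1 with hπ
    have hπ1 : ‖π‖ < 1 := norm_zeta_sub_one_lt_one p hm
    have hπ0 : 0 ≤ ‖π‖ := norm_nonneg _
    -- `x - r(0) = ∑_{j ≥ 1} r_j π^j`
    have hsum : x - algebraMap ℚ_[p] (PadicAlgCl p) (r.coeff 0) =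
        ∑ j ∈ range r.natDegree, r.coeff (j + 1) • π ^ (j + 1) := by
      rw [← hrx, aeval_eq_sum_range, sum_range_succ', pow_zero, Algebra.smul_def, mul_one, add_sub_cancel_right]
    rw [hsum]
    refine lt_of_le_of_lt (IsUltrametricDist.norm_sum_le_of_forall_le_of_nonneg hπ0 fun j _ => ?_) hπ1
    rw [Algebra.smul_def, norm_mul, norm_algebraMap', norm_pow]
    calc ‖r.coeff (j + 1)‖ * ‖π‖ ^ (j + 1) ≤ 1 * ‖π‖ ^ (j + 1) :=
          mul_le_mul_of_nonneg_right (hr _) (pow_nonneg hπ0 _)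
      _ = ‖π‖ ^ (j + 1) := one_mul _
      _ ≤ ‖π‖ := pow_le_of_le_one hπ0 hπ1.le (by omega)

/-- **Residues of layer integers lie in `𝔽_p`**: for `x ∈ ℚ_p(ζ_{p^m})` with `‖x‖ ≤ 1` there is a
natural number `a < p` with `‖x − a‖ < 1` (the residue field of the totally ramified layer is
`𝔽_p`). [cite: SerreLocalFields1979, Ch. IV §4] -/
theorem exists_nat_norm_sub_lt_one {m : ℕ} {x : PadicAlgCl p} (hx : x ∈ layer p m) (hx1 : ‖x‖ ≤ 1) :
    ∃ a : ℕ, a < p ∧ ‖x - a‖ < 1 := by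
  obtain ⟨c, hc1, hxc⟩ := exists_padic_norm_sub_lt_one hx hx1
  set c' : ℤ_[p] := ⟨c, hc1⟩ with hc'
  refine ⟨c'.zmodRepr, PadicInt.zmodRepr_lt_p c', ?_⟩
  have h1 : ‖algebraMap ℚ_[p] (PadicAlgCl p) c - (c'.zmodRepr : PadicAlgCl p)‖ < 1 := by
    have h := PadicInt.norm_sub_zmodRepr_lt_one c'
    rw [← map_natCast (algebraMap ℚ_[p] (PadicAlgCl p)), ← map_sub, norm_algebraMap']
    have e : c - (c'.zmodRepr : ℚ_[p]) = ((c' - (c'.zmodRepr : ℤ_[p]) : ℤ_[p]) : ℚ_[p]) := by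
      rw [PadicInt.coe_sub, PadicInt.coe_natCast]
    rw [e]; exact h
  calc ‖x - (c'.zmodRepr : PadicAlgCl p)‖
      = ‖(x - algebraMap ℚ_[p] (PadicAlgCl p) c) + (algebraMap ℚ_[p] (PadicAlgCl p) c - c'.zmodRepr)‖ := by
        rw [sub_add_sub_cancel]
    _ ≤ max ‖x - algebraMap ℚ_[p] (PadicAlgCl p) c‖ ‖algebraMap ℚ_[p] (PadicAlgCl p) c - c'.zmodRepr‖ :=
        IsUltrametricDist.norm_add_le_max _ _
    _ < 1 := max_lt hxc h1

/-- The residue of a layer integer is the residue of a natural number: for `a : 𝒪` with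
`(a : Ω) ∈ ℚ_p(ζ_{p^m})` there is `n : ℕ` with `residue a = n`. [cite: SerreLocalFields1979, Ch. IV §4] -/
theorem exists_residue_eq_natCast {m : ℕ} (a : intΩ p) (ha : (a : PadicAlgCl p) ∈ layer p m) :
    ∃ n : ℕ, IsLocalRing.residue (intΩ p) a = n := by
  obtain ⟨n, -, hn⟩ := exists_nat_norm_sub_lt_one ha ((mem_intΩ_iff _).mp a.2)
  refine ⟨n, ?_⟩
  rw [← sub_eq_zero, ← map_natCast (IsLocalRing.residue (intΩ p)), ← map_sub,
    ← v_algebraMap_lt_one_iff (integers_intΩ p), v_lt_iff_norm_lt, NNReal.coe_one]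
  rw [map_sub, map_natCast]
  exact hn

/-! ## §3 The reduction of a layer point is an `𝔽_p`-point -/

variable (p) in
/-- The coefficients of the reduction `(M ⊗ 𝒪) mod 𝔪 = (M mod p) ⊗ k` lie in the prime field
`𝔽_p ⊂ k`. [folklore] -/
theorem coeffs_map_residue_mem_fieldRange (M : WeierstrassCurve ℤ_[p]) :
    ((modelΩ p M).map (IsLocalRing.residue (intΩ p))).a₁ ∈ ((zmodToResidueΩ p).fieldRange : Subfield _) ∧
    ((modelΩ p M).map (IsLocalRing.residue (intΩ p))).a₂ ∈ ((zmodToResidueΩ p).fieldRange : Subfield _) ∧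
    ((modelΩ p M).map (IsLocalRing.residue (intΩ p))).a₃ ∈ ((zmodToResidueΩ p).fieldRange : Subfield _) ∧
    ((modelΩ p M).map (IsLocalRing.residue (intΩ p))).a₄ ∈ ((zmodToResidueΩ p).fieldRange : Subfield _) ∧
    ((modelΩ p M).map (IsLocalRing.residue (intΩ p))).a₆ ∈ ((zmodToResidueΩ p).fieldRange : Subfield _) := by
  rw [modelΩ_map_residue]
  simp only [map_a₁, map_a₂, map_a₃, map_a₄, map_a₆]
  exact ⟨RingHom.mem_fieldRange.mpr ⟨_, rfl⟩, RingHom.mem_fieldRange.mpr ⟨_, rfl⟩, RingHom.mem_fieldRange.mpr ⟨_, rfl⟩,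
    RingHom.mem_fieldRange.mpr ⟨_, rfl⟩, RingHom.mem_fieldRange.mpr ⟨_, rfl⟩⟩

variable (p) in
/-- **`Ẽ(𝔽_p) ≤ Ẽ(k)`**: the points of the reduced curve with coordinates in the prime field (the
`subfieldPoints` of the series for the subfield `𝔽_p = im(𝔽_p → k)`). [folklore] -/
abbrev primeFieldPoints (M : WeierstrassCurve ℤ_[p]) :
    AddSubgroup ((modelΩ p M).map (IsLocalRing.residue (intΩ p))).toAffine.Point :=
  subfieldPoints ((modelΩ p M).map (IsLocalRing.residue (intΩ p))) (zmodToResidueΩ p).fieldRange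
    (coeffs_map_residue_mem_fieldRange p M)

/-- **`#Ẽ(𝔽_p)`, read inside `Ẽ(k)`, is the number of `𝔽_p`-points of `M mod p`**: the map on points
along `𝔽_p → k` is a bijection onto the points with coordinates in the prime field. [folklore] -/
theorem natCard_primeFieldPoints (M : WeierstrassCurve ℤ_[p]) :
    Nat.card (primeFieldPoints p M) = Nat.card (M.map PadicInt.toZMod).toAffine.Point := by
  symm
  have hmem : ∀ P : (M.map PadicInt.toZMod).toAffine.Point,
      Affine.Point.congrEquiv (modelΩ_map_residue p M).symm
        ((M.map PadicInt.toZMod).mapPointHom (zmodToResidueΩ p) P) ∈ primeFieldPoints p M := by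
    rintro (_ | ⟨a, b, h⟩)
    · rw [← WeierstrassCurve.Affine.Point.zero_def, map_zero, map_zero]; exact (primeFieldPoints p M).zero_mem
    · rw [WeierstrassCurve.mapPointHom_some, Affine.Point.congrEquiv_some, some_mem_subfieldPoints_iff]
      exact ⟨RingHom.mem_fieldRange.mpr ⟨_, rfl⟩, RingHom.mem_fieldRange.mpr ⟨_, rfl⟩⟩
  refine Nat.card_eq_of_bijective (fun P => ⟨Affine.Point.congrEquiv (modelΩ_map_residue p M).symm
    ((M.map PadicInt.toZMod).mapPointHom (zmodToResidueΩ p) P), hmem P⟩) ⟨?_, ?_⟩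
  · intro P₁ P₂ h12
    have h' := congrArg Subtype.val h12
    exact WeierstrassCurve.mapPointHom_injective _ _
      ((Affine.Point.congrEquiv (modelΩ_map_residue p M).symm).injective h')
  · rintro ⟨R, hR⟩
    rcases R with _ | ⟨x, y, h⟩
    · exact ⟨0, Subtype.ext (by simp only [map_zero]; rfl)⟩
    · obtain ⟨hx, hy⟩ := (some_mem_subfieldPoints_iff _ h).mp hR
      obtain ⟨a, rfl⟩ := RingHom.mem_fieldRange.mp hx
      obtain ⟨b, rfl⟩ := RingHom.mem_fieldRange.mp hy
      have h' : ((M.map PadicInt.toZMod).map (zmodToResidueΩ p)).toAffine.Nonsingular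
          (zmodToResidueΩ p a) (zmodToResidueΩ p b) := by
        rw [← modelΩ_map_residue]; exact h
      have h₀ : (M.map PadicInt.toZMod).toAffine.Nonsingular a b :=
        (Affine.map_nonsingular _ (zmodToResidueΩ_injective p) _ _).mp h'
      refine ⟨.some a b h₀, Subtype.ext ?_⟩
      simp only
      rw [WeierstrassCurve.mapPointHom_some, Affine.Point.congrEquiv_some]

/-- **Lagrange in `Ẽ(𝔽_p)`**: a point of `Ẽ(k)` with coordinates in the prime field is killed by
`#Ẽ(𝔽_p)`. [folklore] -/
theorem natCard_smul_eq_zero_of_mem_primeFieldPoints (M : WeierstrassCurve ℤ_[p])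
    {R : ((modelΩ p M).map (IsLocalRing.residue (intΩ p))).toAffine.Point} (hR : R ∈ primeFieldPoints p M) :
    Nat.card (M.map PadicInt.toZMod).toAffine.Point • R = 0 := by
  have h := card_nsmul_eq_zero' (G := primeFieldPoints p M) (x := ⟨R, hR⟩)
  rw [natCard_primeFieldPoints] at h
  exact congrArg Subtype.val h

/-- **The reduction of a point with coordinates in a layer is an `𝔽_p`-point.** For `M/ℤ_p` with
`M mod p` elliptic and `Q ∈ E_Ω` with coordinates in `ℚ_p(ζ_{p^m})`, the reduction of `Q` (read on
`M ⊗ 𝒪`, Silverman VII.2.1) has coordinates in the prime field of `k`.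
[cite: SilvermanAEC2009, VII.2 Prop. 2.1] [cite: Kobayashi2003, §8.4 (proof of Prop. 8.12)] -/
theorem goodReductionHom_mem_primeFieldPoints (M : WeierstrassCurve ℤ_[p]) [(M.map PadicInt.toZMod).IsElliptic]
    {m : ℕ} {Q : (genFibΩ p M).toAffine.Point}
    (hQ : Q ∈ subfieldPoints (genFibΩ p M) (layer p m).toSubfield coeffs_mem_layer) :
    goodReductionHom (modelΩ p M) (integers_intΩ p) (isUnit_Δ_modelΩ p M)
        (Affine.Point.congrEquiv (modelΩ_baseChange p M).symm Q) ∈ primeFieldPoints p M := by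
  have hv := integers_intΩ p
  have hΔ := isUnit_Δ_modelΩ p M
  set Q' := Affine.Point.congrEquiv (modelΩ_baseChange p M).symm Q with hQ'
  rcases point_cases (W := modelΩ p M) hv Q' with h0 | ⟨x, y, h, hxy, hx⟩ | ⟨a, b, h, hab⟩
  · rw [h0, map_zero]; exact (primeFieldPoints p M).zero_mem
  · rw [hxy, goodReductionHom_apply, WeierstrassCurve.reducePoint_some_of_not_mem h ((not_mem_range_iff hv).mpr hx)]
    exact (primeFieldPoints p M).zero_mem
  · -- the coordinates `a, b` of `Q` lie in the layer
    have hQab : Q = Affine.Point.congrEquiv (modelΩ_baseChange p M) (.some _ _ h) := by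
      rw [← hab, hQ', WeierstrassCurve.congrEquiv_apply_congrEquiv_symm]
    have hmem := hQ _ _ _ (by rw [hQab, Affine.Point.congrEquiv_some])
    obtain ⟨na, hna⟩ := exists_residue_eq_natCast a hmem.1
    obtain ⟨nb, hnb⟩ := exists_residue_eq_natCast b hmem.2
    have hns : ((modelΩ p M).map (IsLocalRing.residue (intΩ p))).toAffine.Nonsingular
        (IsLocalRing.residue (intΩ p) a) (IsLocalRing.residue (intΩ p) b) :=
      (WeierstrassCurve.hasNonsingularReduction_some_algebraMap_iff hv.hom_inj h).mp
        (hasNonsingularReduction_of_isUnit_Δ hv hΔ _)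
    rw [hab, goodReductionHom_apply, WeierstrassCurve.reducePoint_some_algebraMap hv.hom_inj h hns,
      some_mem_subfieldPoints_iff, hna, hnb]
    exact ⟨RingHom.mem_fieldRange.mpr ⟨na, map_natCast _ na⟩, RingHom.mem_fieldRange.mpr ⟨nb, map_natCast _ nb⟩⟩

/-! ## §4 `#Ẽ(𝔽_p) • Q ∈ E₁` and the `hsat` hypothesis -/

/-- **Prime-to-`p` saturation: `#Ẽ(𝔽_p) • Q ∈ E₁` for every point `Q ∈ E_Ω` with coordinates in a
layer `ℚ_p(ζ_{p^m})`** (`M mod p` elliptic): the reduction of `Q` lies in the finite group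
`Ẽ(𝔽_p)`, which is killed by its order, and the kernel of reduction is `E₁ = {‖x‖ > 1} ∪ {O}`.
[cite: SilvermanAEC2009, VII.2 Prop. 2.1] [cite: Kobayashi2003, §8.4 (proof of Prop. 8.12)] -/
theorem card_smul_mem_kernel_of_mem_subfieldPoints (M : WeierstrassCurve ℤ_[p]) [(M.map PadicInt.toZMod).IsElliptic]
    {m : ℕ} {Q : (genFibΩ p M).toAffine.Point}
    (hQ : Q ∈ subfieldPoints (genFibΩ p M) (layer p m).toSubfield coeffs_mem_layer) :
    haveI := isIntegral_genFib_baseChange p M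
    Nat.card (M.map PadicInt.toZMod).toAffine.Point • Q ∈ kernel (Valued.v (R := PadicAlgCl p)) (genFibΩ p M) := by
  have hv := integers_intΩ p
  have hΔ := isUnit_Δ_modelΩ p M
  set N := Nat.card (M.map PadicInt.toZMod).toAffine.Point with hN
  set e := Affine.Point.congrEquiv (modelΩ_baseChange p M).symm with he
  have hred : goodReductionHom (modelΩ p M) hv hΔ (e (N • Q)) = 0 := by
    rw [map_nsmul, map_nsmul, hN]
    exact natCard_smul_eq_zero_of_mem_primeFieldPoints M (goodReductionHom_mem_primeFieldPoints M hQ)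
  have hker : WeierstrassCurve.ReducesToZero (modelΩ p M) (e (N • Q)) :=
    (goodReductionHom_eq_zero_iff hv hΔ _).mp hred
  -- read on `E_Ω`
  intro x y hxy hNQ
  rw [hNQ, he, Affine.Point.congrEquiv_some, WeierstrassCurve.reducesToZero_some_iff, not_mem_range_iff hv] at hker
  exact hker

section Hsat

variable {K : Type} [Field K] [Algebra K ℚ_[p]]
  (ι : AlgebraicClosure K →ₐ[K] AlgebraicClosure ℚ_[p]) (W : WeierstrassCurve K)
  (U : ℕ → Subgroup (Field.absoluteGaloisGroup K))
  (M : WeierstrassCurve ℤ_[p]) [hEt : (M.map PadicInt.toZMod).IsElliptic]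

omit hEt in
/-- `a_p(M) = 0` means `#Ẽ(𝔽_p) = p + 1`. [folklore] -/
theorem natCard_point_eq_of_tr_eq_zero
    (htr : Literature.NumberTheory.EllipticCurves.HasseManin.tr (M.map PadicInt.toZMod) = 0) :
    Nat.card (M.map PadicInt.toZMod).toAffine.Point = p + 1 := by
  rw [Literature.NumberTheory.EllipticCurves.HasseManin.tr, ZMod.card] at htr
  omega

variable {ι W U M}

/-- **`hsat` DISCHARGED.** For a tower `U` whose local subgroups are the stabilisers of
`ζ_{p^{n+1}}` (`K_{n,v} = ℚ_p(ζ_{p^{n+1}})`) and a `ℤ_p`-model `M` of `W ⊗ ℚ̄_p` with `M mod p`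
elliptic and `a_p(M) = 0`: every `P ∈ E(K_{n,v})` satisfies `(p + 1) • P ∈ E₁`, i.e. the
hypothesis `hsat` of `localFixedPointsOfEmb_le_sup_towerSigned` holds with `m' = p + 1 = #Ẽ(𝔽_p)`.
[cite: Kobayashi2003, §8.4 (proof of Prop. 8.12)] [cite: SilvermanAEC2009, VII.2 Prop. 2.1] -/
theorem hsat_of_stab
    (htr : Literature.NumberTheory.EllipticCurves.HasseManin.tr (M.map PadicInt.toZMod) = 0)
    (hU : ∀ n, localSubgroupOfEmb (U n) ι = stab p (n + 1))
    (hWM : M.baseChange (AlgebraicClosure ℚ_[p]) = W.baseChange (AlgebraicClosure ℚ_[p]))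
    (n : ℕ) (P : localPoints W ℚ_[p]) (hP : P ∈ localFixedPointsOfEmb ι W (U n)) :
    ∃ m' : ℕ, m'.Coprime p ∧
      ∀ (x y : AlgebraicClosure ℚ_[p]) (hxy : (W.baseChange (AlgebraicClosure ℚ_[p])).toAffine.Nonsingular x y),
        m' • P = .some x y hxy → 1 < ‖x‖ := by
  have hV : genFibΩ p M = W.baseChange (AlgebraicClosure ℚ_[p]) := (genFibΩ_eq_baseChange M).trans hWM
  haveI hintΩ : (genFibΩ p M).IsIntegral (Valued.v (R := PadicAlgCl p)).integer := isIntegral_genFib_baseChange p M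
  refine ⟨p + 1, by simp, ?_⟩
  have hQ : (toLoc hV).symm P ∈ subfieldPoints (genFibΩ p M) (layer p (n + 1)).toSubfield coeffs_mem_layer :=
    (mem_localFixedPointsOfEmb_iff_mem_subfieldPoints ι hV hU n P).mp hP
  have hker : (p + 1) • (toLoc hV).symm P ∈ kernel (Valued.v (R := PadicAlgCl p)) (genFibΩ p M) := by
    rw [← natCard_point_eq_of_tr_eq_zero (M := M) htr]
    exact card_smul_mem_kernel_of_mem_subfieldPoints M hQ
  rw [← map_nsmul, toLoc_symm_mem_kernel_iff] at hker
  intro x y hxy hxP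
  have := hker x y hxy hxP
  rwa [PadicAlgCl.valuation_def, ← NNReal.coe_lt_coe, coe_nnnorm, NNReal.coe_one] at this

end Hsat

end Summit.BirchSwinnertonDyer.Rank1Residual.Additive

end
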